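import Summits.RiemannHypothesis.RiemannHypothesis.Theorems.MotivicDoorFunctionField
import Summits.RiemannHypothesis.RiemannHypothesis.Theorems.MotivicDoorFfDoor

/-!
# The function-field door for abelian varieties — `hlarge` discharged, door (i) instantiated

Cell `pub-rhdoor`, seat ff-2 (generation 2).  Companion to `MotivicDoorFunctionField` (ff-2, statement (ii):
`RH(q,h) ↔ ∃ E ≥ 1, h^E` is a characteristic polynomial of Frobenius, from the two named Literature facts
`AbelianVariety.weilRiemannHypothesis` (Weil) and `AbelianVariety.hondaTateExistence` (Honda–Tate)) and to
`MotivicDoorFfDoor` (ff-1, statement (i): finite-window readers never certify RH; scale-free readers see exactly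
RH — stated over an ABSTRACT predicate `Geo : ℤ[X] → Prop` with hypotheses `hW`, `hHT`, `hlarge`).

HONEST FRAMING.  Nothing here bears on `riemannZeta`; this is the function-field mirror, where RH is Weil's
theorem.  The cell's line is a lottery ticket at the motivic door; the consolation prizes are theorems like these.

## What this file adds  [all PROVED, 0 sorry; hypotheses ONLY `hW` / `hHT`, the named facts]

* `geo_hlarge` — ff-1's last undischarged hypothesis `hlarge` ("geometric honest data exist in every dimension
  `≥ M+1`") for the geometric predicate `Geo h := ∃ A : AbelianVariety K, A.IsFrobCharpoly h`, from
  `hondaTateExistence K` ALONE: the RH-true quadratic `X² + q` has a geometric power `(X²+q)^E` (Honda–Tate in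
  power form, `exists_pow_isFrobCharpoly_of_weil` — no irreducibility needed), hence so does `(X²+q)^{E(M+1)}`
  (`exists_isFrobCharpoly_pow`, products of abelian varieties); and `(X²+q)^m` is honest of dimension `m`
  (`fe_X_sq_add_C_pow`, via `(X²+q)^m = expand 2 ((X+q)^m)` and the binomial symmetry).
* door (i) FOR ABELIAN VARIETIES: `finiteWindow_never_certifies_rh_geometric`, `scaleFree_hull_iff_rh_geometric`,
  `scaleFree_hull_iff_geometric_pow`, `scaleFree_dichotomy_geometric`, `ffDoor_scaleFree_geometric` — ff-1's
  theorems with `Geo := (∃ A, A.IsFrobCharpoly ·)`, `q := Nat.card K`, every abstract hypothesis discharged.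
* dictionary lemmas RH ⇒ `q`-reciprocity: `frobRoots_map_div_of_rh`, `zero_not_mem_frobRoots_of_rh`; whence the
  side-condition-free form of the window door `geometric_pow_iff_windows_and_reciprocal`
  (`∃ E ≥ 1, h^E geometric ↔ (∀ M, T_M(q,h) ⪰ 0) ∧ roots closed under α ↦ q/α ∧ 0 ∉ roots`), and
  `coeff_zero_eq_of_fe` (FE ⇒ `c₀ = q^g`).
* `ffDoor_abelianVariety` — the packaged FF-DOOR THEOREM, statements (ii) + (i), for abelian varieties over a
  finite field `K`, modulo exactly `hW` and `hHT`.

Caveats (powers / multiplicities; `q = #K` a prime power, any; ordinary vs supersingular irrelevant) are those of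
`MotivicDoorFunctionField` and `Literature.AlgebraicGeometry.Motives.AbelianVarietyHondaTate` (Tate, Sém.
Bourbaki 352, Th. 1 and Rem. 2: for simple `A`, `f_A = (minimal polynomial of π_A)^m`, `m = [E:F]^{1/2}`).
-/

set_option linter.dupNamespace false  -- the mandated namespace repeats `RiemannHypothesis`

open Polynomial
open scoped ComplexOrder

namespace Summit.RiemannHypothesis.RiemannHypothesis.Theorems.MotivicDoor.FunctionField

open Literature.AlgebraicGeometry.Motives
open Summit.RiemannHypothesis.RiemannHypothesis.Theorems.PfPersistence.FfAngleTwin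

universe u

/-! ## 1. Dictionary lemmas: RH ⇒ `q`-reciprocity; FE ⇒ `c₀ = q^g` -/

/-- RH-true integer data are `q`-reciprocal at the multiset level: if every complex root of `h ∈ ℤ[X]` has
absolute value `√q` (`q ≥ 0`), then `α ↦ q/α` acts on the roots as complex conjugation, under which the root
multiset of an integer polynomial is invariant (`frobRoots_map_conj`). [PROVED] -/
theorem frobRoots_map_div_of_rh {q : ℝ} (hq : 0 ≤ q) {h : ℤ[X]}
    (hRH : ∀ α ∈ frobRoots h, ‖α‖ = Real.sqrt q) :
    (frobRoots h).map (fun α => (q : ℂ) / α) = frobRoots h := by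
  conv_rhs => rw [← frobRoots_map_conj h]
  refine Multiset.map_congr rfl fun α hα => ?_
  have hn := hRH α hα
  by_cases hα0 : α = 0
  · subst hα0; simp
  · rw [div_eq_iff hα0, Complex.conj_mul', hn, ← Complex.ofReal_pow, Real.sq_sqrt hq]

/-- RH-true data with `q > 0` have no root at `0`. [PROVED] -/
theorem zero_not_mem_frobRoots_of_rh {q : ℝ} (hq : 0 < q) {h : ℤ[X]}
    (hRH : ∀ α ∈ frobRoots h, ‖α‖ = Real.sqrt q) : (0 : ℂ) ∉ frobRoots h := by
  intro h0
  have := hRH 0 h0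
  rw [norm_zero] at this
  exact (Real.sqrt_pos.2 hq).ne' this.symm

/-- The coefficient functional equation forces `c₀ = q^g` for monic `h` of degree `2g` (`q > 0`). [PROVED] -/
theorem coeff_zero_eq_of_fe {q : ℕ} (hq : 0 < q) {h : ℤ[X]} {g : ℕ} (hh : h.Monic)
    (hdeg : h.natDegree = 2 * g)
    (hFE : ∀ i j, i + j = 2 * g → (q : ℤ) ^ g * h.coeff j = (q : ℤ) ^ i * h.coeff i) :
    h.coeff 0 = (q : ℤ) ^ g := by
  have h1 := hFE (2 * g) 0 (by omega)
  have htop : h.coeff (2 * g) = 1 := by rw [← hdeg]; exact hh.coeff_natDegree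
  rw [htop, mul_one, two_mul, pow_add] at h1
  have hq0 : ((q : ℤ) ^ g) ≠ 0 := pow_ne_zero _ (by exact_mod_cast hq.ne')
  exact mul_left_cancel₀ hq0 h1

/-! ## 2. The honest geometric family `(X² + q)^m` -/

/-- `(X² + q)^m = expand₂ ((X + q)^m)`. [PROVED] -/
theorem X_sq_add_C_pow_eq_expand (q : ℤ) (m : ℕ) :
    (X ^ 2 + C q : ℤ[X]) ^ m = expand ℤ 2 ((X + C q) ^ m) := by
  rw [map_pow, map_add, expand_X, expand_C]

/-- Even coefficients of `(X² + q)^m`: `[X^{2b}] (X²+q)^m = q^{m-b} · C(m,b)`. [PROVED] -/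
theorem coeff_X_sq_add_C_pow_even (q : ℤ) (m b : ℕ) :
    ((X ^ 2 + C q : ℤ[X]) ^ m).coeff (2 * b) = q ^ (m - b) * (m.choose b : ℤ) := by
  rw [X_sq_add_C_pow_eq_expand, mul_comm, coeff_expand_mul two_pos, coeff_X_add_C_pow]

/-- Odd coefficients of `(X² + q)^m` vanish. [PROVED] -/
theorem coeff_X_sq_add_C_pow_odd (q : ℤ) (m : ℕ) {n : ℕ} (hn : ¬ 2 ∣ n) :
    ((X ^ 2 + C q : ℤ[X]) ^ m).coeff n = 0 := by
  rw [X_sq_add_C_pow_eq_expand, coeff_expand two_pos, if_neg hn]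

/-- `(X² + q)^m` satisfies the coefficient functional equation in dimension `g = m`
(`q^m c_j = q^i c_i` for `i + j = 2m`): binomial symmetry `C(m,b) = C(m,m-b)`. [PROVED] -/
theorem fe_X_sq_add_C_pow (q : ℤ) (m : ℕ) :
    ∀ i j, i + j = 2 * m →
      q ^ m * ((X ^ 2 + C q : ℤ[X]) ^ m).coeff j = q ^ i * ((X ^ 2 + C q : ℤ[X]) ^ m).coeff i := by
  intro i j hij
  by_cases hj : 2 ∣ j
  · obtain ⟨b, rfl⟩ := hj
    obtain ⟨t, rfl⟩ : ∃ t, m = t + b := ⟨m - b, by omega⟩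
    obtain rfl : i = 2 * t := by omega
    rw [coeff_X_sq_add_C_pow_even, coeff_X_sq_add_C_pow_even, Nat.add_sub_cancel,
      Nat.add_sub_cancel_left, Nat.choose_symm_add]
    ring
  · have hi : ¬ 2 ∣ i := fun hi => hj (by omega)
    rw [coeff_X_sq_add_C_pow_odd q m hj, coeff_X_sq_add_C_pow_odd q m hi, mul_zero, mul_zero]

/-- `X² + q` is monic. [PROVED] -/
theorem monic_X_sq_add_C (q : ℤ) : (X ^ 2 + C q : ℤ[X]).Monic := by
  monicity!

/-- `X² + q` has degree `2`. [PROVED] -/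
theorem natDegree_X_sq_add_C (q : ℤ) : (X ^ 2 + C q : ℤ[X]).natDegree = 2 := by
  compute_degree!

/-- `X² + q` is RH-true over `𝔽_q`: its roots `±i√q` have absolute value `√q`. [PROVED] -/
theorem frobRoots_norm_eq_of_X_sq_add_C (q : ℕ) :
    ∀ α ∈ frobRoots (X ^ 2 + C (q : ℤ)), ‖α‖ = Real.sqrt q := by
  intro α hα
  have hne : (X ^ 2 + C (q : ℤ) : ℤ[X]).map (Int.castRingHom ℂ) ≠ 0 :=
    ((monic_X_sq_add_C (q : ℤ)).map _).ne_zero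
  have hroot := (Polynomial.mem_roots hne).1 hα
  have h2 : α ^ 2 = -(q : ℂ) := by
    have : α ^ 2 + (q : ℂ) = 0 := by simpa [Polynomial.eval_map] using hroot
    linear_combination this
  have hn : ‖α‖ ^ 2 = (Real.sqrt q) ^ 2 := by
    rw [← norm_pow, h2, norm_neg, Complex.norm_natCast, Real.sq_sqrt (Nat.cast_nonneg _)]
  exact (pow_left_inj₀ (norm_nonneg α) (Real.sqrt_nonneg _) two_ne_zero).1 hn

section AbelianVarieties

variable {K : Type u} [Field K] [Finite K]

omit [Finite K] in
/-- A finite field has at least two elements. [PROVED] -/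
theorem two_le_natCard [Finite K] : 2 ≤ Nat.card K := by
  have : 1 < Nat.card K := Finite.one_lt_card
  omega

/-- **`hlarge` DISCHARGED (ff-1's `finiteWindow_never_certifies_ffRH`, last open hypothesis).**  From
Honda–Tate existence alone: in every dimension `g ≥ M+1` — indeed in dimension `E(M+1)` for the Honda–Tate
exponent `E` of `X² + q` — there is an honest datum `(q, h)`, `q = #K`, which IS the characteristic polynomial
of the Frobenius of an abelian variety over `K`: `h = (X² + q)^{E(M+1)}` (a power of a supersingular one;
products of abelian varieties multiply characteristic polynomials).  [PROVED from `hondaTateExistence`] -/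
theorem geo_hlarge (hHT : AbelianVariety.hondaTateExistence K) (M : ℕ) :
    ∃ (g : ℕ) (h : ℤ[X]), M + 1 ≤ g ∧ (∃ A : AbelianVariety K, A.IsFrobCharpoly h) ∧ h.Monic ∧
      h.natDegree = 2 * g ∧
      ∀ i j, i + j = 2 * g → (Nat.card K : ℤ) ^ g * h.coeff j = (Nat.card K : ℤ) ^ i * h.coeff i := by
  have hm0 := monic_X_sq_add_C (Nat.card K : ℤ)
  have hdeg0 := natDegree_X_sq_add_C (Nat.card K : ℤ)
  obtain ⟨E, hE, C, hC⟩ := exists_pow_geometric_of_rh hHT hm0 (by rw [hdeg0]; exact two_pos)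
    (frobRoots_norm_eq_of_X_sq_add_C (Nat.card K))
  obtain ⟨D, hD⟩ := AbelianVariety.exists_isFrobCharpoly_pow hC (Nat.succ_pos M)
  refine ⟨E * (M + 1), (X ^ 2 + Polynomial.C (Nat.card K : ℤ)) ^ (E * (M + 1)),
    Nat.le_mul_of_pos_left (M + 1) hE, ⟨D, by rwa [← pow_mul] at hD⟩, hm0.pow _, ?_,
    fe_X_sq_add_C_pow (Nat.card K : ℤ) (E * (M + 1))⟩
  rw [hm0.natDegree_pow, hdeg0, mul_comm]

/-! ## 3. Door (i) for abelian varieties: every abstract hypothesis discharged -/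

/-- **FF-DOOR (i), FINITE WINDOWS, FOR ABELIAN VARIETIES.**  Over a finite field `K`, `q = #K`: every predicate
of the window tower that depends only on the windows `T_0, …, T_M` and holds for the tower of every characteristic
polynomial of Frobenius is satisfied by an HONEST datum (monic, degree `2g`, functional equation, `g ≥ M+1`) that
VIOLATES RH.  No finite-window reader certifies RH.  [PROVED from `hondaTateExistence`] -/
theorem finiteWindow_never_certifies_rh_geometric (hHT : AbelianVariety.hondaTateExistence K)
    {Φ : Tower → Prop} {M : ℕ} (hloc : ∀ T T' : Tower, (∀ M' ≤ M, T M' = T' M') → Φ T → Φ T')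
    (hGeo : ∀ h, (∃ A : AbelianVariety K, A.IsFrobCharpoly h) → Φ (weilWindowTower (Nat.card K : ℝ) h)) :
    ∃ (g : ℕ) (h' : ℤ[X]), M + 1 ≤ g ∧ h'.Monic ∧ h'.natDegree = 2 * g ∧
      (∀ i j, i + j = 2 * g → (Nat.card K : ℤ) ^ g * h'.coeff j = (Nat.card K : ℤ) ^ i * h'.coeff i) ∧
      (¬ ∀ α ∈ frobRoots h', ‖α‖ = Real.sqrt (Nat.card K)) ∧ Φ (weilWindowTower (Nat.card K : ℝ) h') :=
  finiteWindow_never_certifies_ffRH hloc two_le_natCard (geo_hlarge hHT M) hGeo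

/-- **FF-DOOR (i), SCALE-FREE HULL, FOR ABELIAN VARIETIES.**  For an honest datum `(q,h)`, `q = #K`:
`(q,h)` is accepted by EVERY scale-free reader true on all characteristic polynomials of Frobenius
`↔ RH(q,h)`.  [PROVED from `weilRiemannHypothesis`, `hondaTateExistence`] -/
theorem scaleFree_hull_iff_rh_geometric (hW : ∀ A : AbelianVariety K, A.weilRiemannHypothesis)
    (hHT : AbelianVariety.hondaTateExistence K) {g : ℕ} {h : ℤ[X]} (hg : 1 ≤ g) (hh : h.Monic)
    (hdeg : h.natDegree = 2 * g)
    (hFE : ∀ i j, i + j = 2 * g → (Nat.card K : ℤ) ^ g * h.coeff j = (Nat.card K : ℤ) ^ i * h.coeff i) :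
    (∀ Φ : Tower → Prop, (∀ c : ℝ, 0 < c → ∀ T : Tower, Φ (Tower.scale c T) = Φ T) →
      (∀ h', (∃ A : AbelianVariety K, A.IsFrobCharpoly h') → Φ (weilWindowTower (Nat.card K : ℝ) h')) →
        Φ (weilWindowTower (Nat.card K : ℝ) h))
      ↔ ∀ α ∈ frobRoots h, ‖α‖ = Real.sqrt (Nat.card K) :=
  scaleFree_hull_iff_ffRH Nat.card_pos (geo_weil hW) (geo_hondaTate_powerForm hHT) hg hh hdeg hFE

/-- **THE SCALE-FREE HULL OF THE GEOMETRIC TOWERS IS THE POWER-CLOSURE OF THE GEOMETRIC DATA.**  For an honest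
datum `(q,h)`: accepted by every scale-free reader true on all Frobenius towers `↔ ∃ E ≥ 1, h^E` is a
characteristic polynomial of Frobenius.  [PROVED from `weilRiemannHypothesis`, `hondaTateExistence`] -/
theorem scaleFree_hull_iff_geometric_pow (hW : ∀ A : AbelianVariety K, A.weilRiemannHypothesis)
    (hHT : AbelianVariety.hondaTateExistence K) {g : ℕ} {h : ℤ[X]} (hg : 1 ≤ g) (hh : h.Monic)
    (hdeg : h.natDegree = 2 * g)
    (hFE : ∀ i j, i + j = 2 * g → (Nat.card K : ℤ) ^ g * h.coeff j = (Nat.card K : ℤ) ^ i * h.coeff i) :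
    (∀ Φ : Tower → Prop, (∀ c : ℝ, 0 < c → ∀ T : Tower, Φ (Tower.scale c T) = Φ T) →
      (∀ h', (∃ A : AbelianVariety K, A.IsFrobCharpoly h') → Φ (weilWindowTower (Nat.card K : ℝ) h')) →
        Φ (weilWindowTower (Nat.card K : ℝ) h))
      ↔ ∃ E : ℕ, 0 < E ∧ ∃ C : AbelianVariety K, C.IsFrobCharpoly (h ^ E) :=
  (scaleFree_hull_iff_rh_geometric hW hHT hg hh hdeg hFE).trans
    (rh_iff_exists_pow_geometric hW hHT hh (by omega))

/-- **FF-DOOR (i), SCALE-FREE DICHOTOMY, FOR ABELIAN VARIETIES.**  A scale-free reader true on all Frobenius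
towers EITHER accepts an honest RH-false datum OR coincides with RH on honest data.
[PROVED from `hondaTateExistence`] -/
theorem scaleFree_dichotomy_geometric (hHT : AbelianVariety.hondaTateExistence K) {Φ : Tower → Prop}
    (hΦ : ∀ c : ℝ, 0 < c → ∀ T : Tower, Φ (Tower.scale c T) = Φ T)
    (hGeo : ∀ h, (∃ A : AbelianVariety K, A.IsFrobCharpoly h) → Φ (weilWindowTower (Nat.card K : ℝ) h)) :
    (∃ (g : ℕ) (h : ℤ[X]), 1 ≤ g ∧ h.Monic ∧ h.natDegree = 2 * g ∧
        (∀ i j, i + j = 2 * g → (Nat.card K : ℤ) ^ g * h.coeff j = (Nat.card K : ℤ) ^ i * h.coeff i) ∧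
        (¬ ∀ α ∈ frobRoots h, ‖α‖ = Real.sqrt (Nat.card K)) ∧ Φ (weilWindowTower (Nat.card K : ℝ) h)) ∨
      (∀ (g : ℕ) (h : ℤ[X]), 1 ≤ g → h.Monic → h.natDegree = 2 * g →
        (∀ i j, i + j = 2 * g → (Nat.card K : ℤ) ^ g * h.coeff j = (Nat.card K : ℤ) ^ i * h.coeff i) →
        (Φ (weilWindowTower (Nat.card K : ℝ) h) ↔ ∀ α ∈ frobRoots h, ‖α‖ = Real.sqrt (Nat.card K))) :=
  scaleFree_dichotomy hΦ (geo_hondaTate_powerForm hHT) hGeo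

/-- **FF-DOOR (i), SCALE-FREE READERS, PACKAGED, FOR ABELIAN VARIETIES** (ff-1's `ffDoor_scaleFree` with
`Geo := "is a characteristic polynomial of Frobenius over K"`).  [PROVED from `hondaTateExistence`] -/
theorem ffDoor_scaleFree_geometric (hHT : AbelianVariety.hondaTateExistence K) {Φ : Tower → Prop}
    (hΦ : ∀ c : ℝ, 0 < c → ∀ T : Tower, Φ (Tower.scale c T) = Φ T)
    (hGeo : ∀ h, (∃ A : AbelianVariety K, A.IsFrobCharpoly h) → Φ (weilWindowTower (Nat.card K : ℝ) h)) :
    (∀ (g : ℕ) (h : ℤ[X]), 1 ≤ g → h.Monic → h.natDegree = 2 * g →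
        (∀ i j, i + j = 2 * g → (Nat.card K : ℤ) ^ g * h.coeff j = (Nat.card K : ℤ) ^ i * h.coeff i) →
        (∀ α ∈ frobRoots h, ‖α‖ = Real.sqrt (Nat.card K)) → Φ (weilWindowTower (Nat.card K : ℝ) h)) ∧
    ((∃ (g : ℕ) (h : ℤ[X]), 1 ≤ g ∧ h.Monic ∧ h.natDegree = 2 * g ∧
        (∀ i j, i + j = 2 * g → (Nat.card K : ℤ) ^ g * h.coeff j = (Nat.card K : ℤ) ^ i * h.coeff i) ∧
        (¬ ∀ α ∈ frobRoots h, ‖α‖ = Real.sqrt (Nat.card K)) ∧ Φ (weilWindowTower (Nat.card K : ℝ) h)) ∨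
      (∀ (g : ℕ) (h : ℤ[X]), 1 ≤ g → h.Monic → h.natDegree = 2 * g →
        (∀ i j, i + j = 2 * g → (Nat.card K : ℤ) ^ g * h.coeff j = (Nat.card K : ℤ) ^ i * h.coeff i) →
        (Φ (weilWindowTower (Nat.card K : ℝ) h) ↔ ∀ α ∈ frobRoots h, ‖α‖ = Real.sqrt (Nat.card K)))) :=
  ffDoor_scaleFree hΦ (geo_hondaTate_powerForm hHT) hGeo

/-! ## 4. The window door without side conditions -/

/-- **GEOMETRIC ORIGIN UP TO A POWER ⟺ PSD WINDOW TOWER + `q`-RECIPROCITY**, for EVERY monic `h ∈ ℤ[X]` of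
positive degree (no functional equation assumed): the side conditions of
`windows_posSemidef_iff_exists_pow_geometric` are themselves consequences of geometric origin (Weil's RH makes
`α ↦ q/α` complex conjugation on the roots).  The RH-false PSD datum `(4, (X-1)²)` of `PfPersistenceFfWeilCriterion`
shows the reciprocity clause cannot be dropped.  [PROVED from `weilRiemannHypothesis`, `hondaTateExistence`] -/
theorem geometric_pow_iff_windows_and_reciprocal (hW : ∀ A : AbelianVariety K, A.weilRiemannHypothesis)
    (hHT : AbelianVariety.hondaTateExistence K) {h : ℤ[X]} (hm : h.Monic) (hdeg : 0 < h.natDegree) :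
    (∃ E : ℕ, 0 < E ∧ ∃ C : AbelianVariety K, C.IsFrobCharpoly (h ^ E)) ↔
      ((∀ M, (weilWindowForm (Nat.card K) h M).PosSemidef) ∧
        (frobRoots h).map (fun α => ((Nat.card K : ℝ) : ℂ) / α) = frobRoots h ∧ (0 : ℂ) ∉ frobRoots h) := by
  constructor
  · rintro ⟨E, hE, C, hC⟩
    have hRH := rh_of_geometric_pow hW hE hC
    exact ⟨weilWindowForm_posSemidef_of_geometric_pow hW hE hC,
      frobRoots_map_div_of_rh (Nat.cast_nonneg _) hRH, zero_not_mem_frobRoots_of_rh natCard_pos_real hRH⟩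
  · rintro ⟨hpsd, hrec, h0⟩
    exact (windows_posSemidef_iff_exists_pow_geometric hW hHT hm hdeg hrec h0).1 hpsd

/-! ## 5. The FF-door theorem of record, for abelian varieties -/

/-- **THE FUNCTION-FIELD DOOR THEOREM FOR ABELIAN VARIETIES OVER A FINITE FIELD `K`, `q = #K`** — statements
(ii) and (i) together, modulo exactly the two named Literature facts `weilRiemannHypothesis` (Weil 1948) and
`hondaTateExistence` (Honda 1968 / Tate 1966, 1968):
(ii) for every monic `h ∈ ℤ[X]` of positive degree, `RH(q,h) ↔` some power `h^E`, `E ≥ 1`, is the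
  characteristic polynomial of the Frobenius of an abelian variety over `K` ("no honest fakes up to powers";
  the power is essential: `P_A = m_π^e`, Tate);
(i-fin) for every `M` and every reader of the window tower depending only on `T_0..T_M` and true on all
  Frobenius towers, some honest RH-FALSE datum of dimension `≥ M+1` passes it;
(i-sf) for every honest datum, acceptance by all scale-free readers true on Frobenius towers `↔ RH`.
[PROVED from hW, hHT; no claim about ζ] -/
theorem ffDoor_abelianVariety (hW : ∀ A : AbelianVariety K, A.weilRiemannHypothesis)
    (hHT : AbelianVariety.hondaTateExistence K) :
    (∀ h : ℤ[X], h.Monic → 0 < h.natDegree →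
      ((∀ α ∈ frobRoots h, ‖α‖ = Real.sqrt (Nat.card K)) ↔
        ∃ E : ℕ, 0 < E ∧ ∃ C : AbelianVariety K, C.IsFrobCharpoly (h ^ E))) ∧
    (∀ (M : ℕ) (Φ : Tower → Prop), (∀ T T' : Tower, (∀ M' ≤ M, T M' = T' M') → Φ T → Φ T') →
      (∀ h, (∃ A : AbelianVariety K, A.IsFrobCharpoly h) → Φ (weilWindowTower (Nat.card K : ℝ) h)) →
      ∃ (g : ℕ) (h' : ℤ[X]), M + 1 ≤ g ∧ h'.Monic ∧ h'.natDegree = 2 * g ∧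
        (∀ i j, i + j = 2 * g → (Nat.card K : ℤ) ^ g * h'.coeff j = (Nat.card K : ℤ) ^ i * h'.coeff i) ∧
        (¬ ∀ α ∈ frobRoots h', ‖α‖ = Real.sqrt (Nat.card K)) ∧ Φ (weilWindowTower (Nat.card K : ℝ) h')) ∧
    (∀ (g : ℕ) (h : ℤ[X]), 1 ≤ g → h.Monic → h.natDegree = 2 * g →
      (∀ i j, i + j = 2 * g → (Nat.card K : ℤ) ^ g * h.coeff j = (Nat.card K : ℤ) ^ i * h.coeff i) →
      ((∀ Φ : Tower → Prop, (∀ c : ℝ, 0 < c → ∀ T : Tower, Φ (Tower.scale c T) = Φ T) →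
          (∀ h', (∃ A : AbelianVariety K, A.IsFrobCharpoly h') → Φ (weilWindowTower (Nat.card K : ℝ) h')) →
            Φ (weilWindowTower (Nat.card K : ℝ) h))
        ↔ ∀ α ∈ frobRoots h, ‖α‖ = Real.sqrt (Nat.card K))) :=
  ⟨fun _ hm hdeg => rh_iff_exists_pow_geometric hW hHT hm hdeg,
    fun _ _ hloc hGeo => finiteWindow_never_certifies_rh_geometric hHT hloc hGeo,
    fun _ _ hg hh hdeg hFE => scaleFree_hull_iff_rh_geometric hW hHT hg hh hdeg hFE⟩

end AbelianVarieties

end Summit.RiemannHypothesis.RiemannHypothesis.Theorems.MotivicDoor.FunctionField
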